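import Mathlib
import HarnessLib
import Summits.NavierStokesRegularity.NavierStokesRegularity.Theorems.PoloidalWindowDoorLrcModEntireTwistingTHOscAncientLiouvilleForced
import Summits.NavierStokesRegularity.NavierStokesRegularity.Theorems.PoloidalWindowDoorLrcModEntireTwistingTHOscLiouvillePoly
import Summits.NavierStokesRegularity.NavierStokesRegularity.Theorems.PoloidalWindowDoorLrcModEntireTwistingTHOscRegularisedAbs

/-!
# Item `LrcModEntire` (stmt-NavierStokesRegularity-20428), skeleton twist_split v6, CLASS road to `stub_twistingTHGerm` —
# the SIGNED (Kato) form of the ancient Liouville theorem for the similarity-variable plane-oscillation law, every compression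

Cell ns-regularity-ideate, seat ns-k2-port-2 g4 (kernel-port lineage; `--supports stmt-NavierStokesRegularity-20428 --as helper`; sequel of
`…TwistingTHOscAncientLiouvilleForced` and `…TwistingTHOscRegularisedAbs`).  MOTIVATION (LEAD memo OSC-LIOUVILLE-g13 v1.5 §5septies, «residual
technical points under (BRANCH): planes with μ = 1»): the object the (BRANCH) hypothesis produces is `U = (1−μ)(Θ⁺ − Θ⁻)` — SMOOTH, of BOTH signs —
and port-2's touching lemma `osc_sub_sup` gives (OSC) for `U` where `1−μ > 0` and for `−U` where `1−μ < 0` (the roles of the plane max / min of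
`W = (1−μ)v₂` swap), i.e. the single pointwise SIGNED inequality `U·(∂U + ½∂((ξ+Ŝ)U) − ∂²U) ≤ 0`; the non-negative object `|U|` is only Lipschitz
across `U = 0`, so the `C²` hypothesis of `…TwistingTHOscLiouville.eq_zero_of_ancient_oscSubsolution_anyK` is not met by it.  This file removes the issue:

* `weightedMass_reg_le` — for `ε > 0` the regularisation `Q_ε := √(U² + ε²)` is `C²`, polynomially bounded with its derivatives, and a FORCED
  subsolution `∂_τQ_ε + ½∂_ξ((ξ+S)Q_ε) ≤ ∂_ξξQ_ε + ½(1+S_ξ)ε²/Q_ε` (`reg_forced_ineq`) with forcing `≤ ½(1+C)ε·(1+ξ²)^{2k}`, so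
  `weightedMass_le_of_forced` gives `∫ Q_ε(τ,ξ)w(ξ)dξ ≤ ((1+C)ε/2γ)·∫(1+ξ²)^{2k}w` for a universal weight `w`;
* `eq_zero_of_ancient_signedSolution` — `U : ℝ → ℝ → ℝ` with `U(τ,·) ∈ C²`, time derivative `Ut` (continuous in `ξ`), POLYNOMIAL bounds
  `|U|, |Ut|, |U_ξ|, |U_ξξ| ≤ C(1+ξ²)^k`, `S(τ,·) ∈ C¹`, `|S| ≤ A` (`A > 0`), `|S_ξ| ≤ C(1+ξ²)^k`, and the SIGNED inequality
  `U·(Ut + ½∂_ξ((ξ+S)U) − U_ξξ) ≤ 0` on `ℝ × ℝ` ⇒ `U ≡ 0` (the LEAD's explicit weight `exists_universalWeight₂`; `∫|U|w ≤ ∫Q_ε w = O(ε)`).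

WHAT THIS IS NOT: not a claim about Navier–Stokes regularity and not the stub (bears_on LADDER-NS N0, item 20428 / crux 19708; both OPEN) —
a 1-D linear parabolic Liouville lemma; the derivation of the signed object from a class profile ((BRANCH)) is NOT here.
-/

noncomputable section

-- the summit and its single sub-problem share the name (CONVENTIONS §1), as in every Theorems file
set_option linter.dupNamespace false

namespace Summit.NavierStokesRegularity.NavierStokesRegularity.Theorems.PoloidalWindowDoorLrcModEntireTwistingTHOscSignedLiouville

open MeasureTheory Set Filter Topology

open Summit.NavierStokesRegularity.NavierStokesRegularity.Theorems.PoloidalWindowDoorLrcModEntireTwistingTHOscAncientLiouville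
open Summit.NavierStokesRegularity.NavierStokesRegularity.Theorems.PoloidalWindowDoorLrcModEntireTwistingTHOscAncientLiouvilleForced
open Summit.NavierStokesRegularity.NavierStokesRegularity.Theorems.PoloidalWindowDoorLrcModEntireTwistingTHOscUniversalWeightCurvature
open Summit.NavierStokesRegularity.NavierStokesRegularity.Theorems.PoloidalWindowDoorLrcModEntireTwistingTHOscLiouvillePoly
open Summit.NavierStokesRegularity.NavierStokesRegularity.Theorems.PoloidalWindowDoorLrcModEntireTwistingTHOscRegularisedAbs

/-! ### The regularised family `Q_ε = √(U² + ε²)` is a forced subsolution; its weighted mass is `O(ε)` -/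

/-- **THE WEIGHTED MASS OF `√(U²+ε²)` IS `O(ε)`** for a polynomially bounded smooth signed solution `U` (module docstring) and a universal
weight `w` with rate `γ > 0` and `(1+ξ²)^{4k+1}`-moments: for `ε > 0`,
`∫ √(U(τ,ξ)² + ε²)·w(ξ)dξ ≤ ((1+C)ε/2)/γ · ∫(1+ξ²)^{2k} w` for every `τ` (and the integrand is integrable). -/
theorem weightedMass_reg_le {U Ut S : ℝ → ℝ → ℝ} {w : ℝ → ℝ} {A γ C ε : ℝ} {k : ℕ}
    (hw : ContDiff ℝ 2 w) (hwpos : ∀ ξ, 0 < w ξ) (hγ : 0 < γ)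
    (hLw : ∀ ξ s : ℝ, |s| ≤ A → deriv (deriv w) ξ + (1 / 2 : ℝ) * (ξ + s) * deriv w ξ ≤ -γ * w ξ)
    (hWint : Integrable fun ξ => (1 + ξ ^ 2) ^ (2 * (2 * k) + 1) * (|w ξ| + |deriv w ξ| + |deriv (deriv w) ξ|))
    (hU2 : ∀ τ, ContDiff ℝ 2 (U τ)) (hUt : ∀ τ ξ, HasDerivAt (fun τ' => U τ' ξ) (Ut τ ξ) τ) (hUtc : ∀ τ, Continuous (Ut τ))
    (hUb : ∀ τ ξ, |U τ ξ| ≤ C * (1 + ξ ^ 2) ^ k)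
    (hUtb : ∀ τ ξ, |Ut τ ξ| ≤ C * (1 + ξ ^ 2) ^ k) (hU1b : ∀ τ ξ, |deriv (U τ) ξ| ≤ C * (1 + ξ ^ 2) ^ k)
    (hU2b : ∀ τ ξ, |deriv (deriv (U τ)) ξ| ≤ C * (1 + ξ ^ 2) ^ k)
    (hS : ∀ τ, ContDiff ℝ 1 (S τ)) (hSA : ∀ τ ξ, |S τ ξ| ≤ A) (hS1b : ∀ τ ξ, |deriv (S τ) ξ| ≤ C * (1 + ξ ^ 2) ^ k)
    (hsgn : ∀ τ ξ, U τ ξ * (Ut τ ξ + (1 / 2 : ℝ) * deriv (fun ξ => (ξ + S τ ξ) * U τ ξ) ξ - deriv (deriv (U τ)) ξ) ≤ 0)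
    (hε : 0 < ε) :
    (∀ τ, Integrable fun ξ => Real.sqrt (U τ ξ ^ 2 + ε ^ 2) * w ξ) ∧
    ∀ τ, ∫ ξ, Real.sqrt (U τ ξ ^ 2 + ε ^ 2) * w ξ ≤ ((1 + C) / 2 * ε) / γ * ∫ ξ, (1 + ξ ^ 2) ^ (2 * k) * w ξ := by
  have hC0 : 0 ≤ C := by
    have := (abs_nonneg _).trans (hUtb 0 0)
    have hP : 0 < (1 + (0 : ℝ) ^ 2) ^ k := by positivity
    nlinarith
  -- the regularised family and its derivatives
  set Q : ℝ → ℝ → ℝ := fun τ ξ => Real.sqrt (U τ ξ ^ 2 + ε ^ 2) with hQ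
  set Qt : ℝ → ℝ → ℝ := fun τ ξ => U τ ξ * Ut τ ξ * (Q τ ξ)⁻¹ with hQt
  set F : ℝ → ℝ → ℝ := fun τ ξ => 1 / 2 * (1 + deriv (S τ) ξ) * ε ^ 2 * (Q τ ξ)⁻¹ with hF
  have hUd : ∀ τ, Differentiable ℝ (U τ) := fun τ => (hU2 τ).differentiable (by norm_num)
  have hU1 : ∀ τ, ContDiff ℝ 1 (deriv (U τ)) := fun τ => by
    have h2 : ContDiff ℝ (1 + 1) (U τ) := by rw [one_add_one_eq_two]; exact hU2 τ
    exact h2.deriv'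
  have hU'd : ∀ τ, Differentiable ℝ (deriv (U τ)) := fun τ => (hU1 τ).differentiable (by norm_num)
  have hSd : ∀ τ, Differentiable ℝ (S τ) := fun τ => (hS τ).differentiable (by norm_num)
  have hfacts : ∀ τ ξ, 0 < Q τ ξ ∧ Q τ ξ ^ 2 = U τ ξ ^ 2 + ε ^ 2 ∧ |U τ ξ| ≤ Q τ ξ ∧ ε ≤ Q τ ξ ∧ Q τ ξ ≤ |U τ ξ| + ε :=
    fun τ ξ => reg_facts (u := U τ ξ) hε
  have hQ1 : ∀ τ, deriv (Q τ) = fun ξ => U τ ξ * deriv (U τ) ξ * (Q τ ξ)⁻¹ := fun τ => by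
    have h := deriv_reg (f := U τ) hε (hUd τ)
    simp only [hQ]
    rw [h]; funext ξ; rw [div_eq_mul_inv]
  have hQ2d : ∀ τ ξ, HasDerivAt (deriv (Q τ))
      ((deriv (U τ) ξ ^ 2 + U τ ξ * deriv (deriv (U τ)) ξ) * (Q τ ξ)⁻¹ - U τ ξ ^ 2 * deriv (U τ) ξ ^ 2 * (Q τ ξ)⁻¹ ^ 3) ξ :=
    fun τ ξ => hasDerivAt_deriv_reg (f := U τ) hε (hU2 τ) ξ
  have hQ2 : ∀ τ ξ, deriv (deriv (Q τ)) ξ =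
      (deriv (U τ) ξ ^ 2 + U τ ξ * deriv (deriv (U τ)) ξ) * (Q τ ξ)⁻¹ - U τ ξ ^ 2 * deriv (U τ) ξ ^ 2 * (Q τ ξ)⁻¹ ^ 3 :=
    fun τ ξ => (hQ2d τ ξ).deriv
  -- polynomial weights
  have hP1 : ∀ ξ : ℝ, 1 ≤ (1 + ξ ^ 2) ^ k := fun ξ => one_le_pow₀ (by nlinarith [sq_nonneg ξ])
  have hPP : ∀ ξ : ℝ, (1 + ξ ^ 2) ^ k ≤ (1 + ξ ^ 2) ^ (2 * k) := fun ξ =>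
    pow_le_pow_right₀ (by nlinarith [sq_nonneg ξ]) (by omega)
  have hP2 : ∀ ξ : ℝ, (1 + ξ ^ 2) ^ (2 * k) = (1 + ξ ^ 2) ^ k * (1 + ξ ^ 2) ^ k := fun ξ => by rw [← pow_add]; ring_nf
  -- the constant of the family
  set C' : ℝ := 2 * C ^ 2 / ε + 2 * C + ε + 1 with hC'
  have hCC' : C ≤ C' := by
    have : 0 ≤ 2 * C ^ 2 / ε := by positivity
    simp only [hC']; linarith
  have hC'0 : 0 ≤ C' := hC0.trans hCC'
  have hbd1 : ∀ ξ (a : ℝ), |a| ≤ C * (1 + ξ ^ 2) ^ k → |a| ≤ C' * (1 + ξ ^ 2) ^ (2 * k) := fun ξ a ha =>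
    ha.trans (mul_le_mul hCC' (hPP ξ) (by positivity) hC'0)
  -- ### apply the forced decay law
  have key := weightedMass_le_of_forced (Q := Q) (Qt := Qt) (S := S) (F := F) (A := A) (γ := γ) (C := C')
    (β := (1 + C) / 2 * ε) (k := 2 * k) hw hwpos hγ hLw hWint
    (fun τ => contDiff_reg hε (hU2 τ))
    (fun τ ξ => by
      -- time derivative of the regularisation
      obtain ⟨hq, -, -, -, -⟩ := hfacts τ ξ
      have hpos : U τ ξ * U τ ξ + ε ^ 2 ≠ 0 := by rw [← sq]; positivity
      have h1 : HasDerivAt (fun τ' => U τ' ξ * U τ' ξ + ε ^ 2) (Ut τ ξ * U τ ξ + U τ ξ * Ut τ ξ) τ :=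
        ((hUt τ ξ).mul (hUt τ ξ)).add_const (ε ^ 2)
      have h2 := h1.sqrt hpos
      have e : (fun τ' => Real.sqrt (U τ' ξ * U τ' ξ + ε ^ 2)) = fun τ' => Q τ' ξ := by
        funext τ'; simp only [hQ, sq]
      rw [e] at h2
      have e2 : Real.sqrt (U τ ξ * U τ ξ + ε ^ 2) = Q τ ξ := by simp only [hQ, sq]
      rw [e2] at h2
      refine h2.congr_deriv ?_
      simp only [hQt]
      field_simp
      ring)
    (fun τ => by
      have hQc : Continuous (Q τ) := (contDiff_reg hε (hU2 τ)).continuous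
      have hQi : Continuous fun ξ => (Q τ ξ)⁻¹ := hQc.inv₀ fun ξ => (hfacts τ ξ).1.ne'
      simp only [hQt]
      exact ((hUd τ).continuous.mul (hUtc τ)).mul hQi)
    (fun τ ξ => (hfacts τ ξ).1.le)
    (fun τ ξ => by
      -- `|Q| ≤ |U| + ε ≤ (C + ε)(1+ξ²)^{2k}`
      obtain ⟨hq, -, -, -, hle⟩ := hfacts τ ξ
      rw [abs_of_pos hq]
      have h1 := hUb τ ξ
      have hP := hP1 ξ
      have hP' := hPP ξ
      have : |U τ ξ| + ε ≤ C' * (1 + ξ ^ 2) ^ (2 * k) := by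
        have h3 : C * (1 + ξ ^ 2) ^ k + ε ≤ (C + ε) * (1 + ξ ^ 2) ^ (2 * k) := by
          nlinarith [mul_nonneg hC0 (sub_nonneg.2 hP'), mul_nonneg hε.le (sub_nonneg.2 (hP.trans hP'))]
        have h4 : (C + ε) * (1 + ξ ^ 2) ^ (2 * k) ≤ C' * (1 + ξ ^ 2) ^ (2 * k) :=
          mul_le_mul_of_nonneg_right (by simp only [hC']; nlinarith [sq_nonneg C, div_nonneg (by positivity : (0:ℝ) ≤ 2 * C ^ 2) hε.le])
            (by positivity)
        linarith
      exact hle.trans this)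
    (fun τ ξ => by
      simp only [hQt]
      exact hbd1 ξ _ ((abs_mul_mul_inv_reg_le (f := U τ) hε ξ (Ut τ ξ)).trans (hUtb τ ξ)))
    (fun τ ξ => by
      rw [hQ1 τ]
      exact hbd1 ξ _ ((abs_mul_mul_inv_reg_le (f := U τ) hε ξ (deriv (U τ) ξ)).trans (hU1b τ ξ)))
    (fun τ ξ => by
      rw [hQ2 τ ξ]
      have h := abs_deriv_deriv_reg_le (f := U τ) hε ξ
      have h1 := hU1b τ ξ
      have h2 := hU2b τ ξ
      have hsq : deriv (U τ) ξ ^ 2 ≤ C ^ 2 * (1 + ξ ^ 2) ^ (2 * k) := by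
        rw [hP2 ξ]
        calc deriv (U τ) ξ ^ 2 = |deriv (U τ) ξ| ^ 2 := (sq_abs _).symm
          _ ≤ (C * (1 + ξ ^ 2) ^ k) ^ 2 := pow_le_pow_left₀ (abs_nonneg _) h1 2
          _ = C ^ 2 * ((1 + ξ ^ 2) ^ k * (1 + ξ ^ 2) ^ k) := by ring
      have hP' := hPP ξ
      have h3 : 2 * deriv (U τ) ξ ^ 2 / ε + |deriv (deriv (U τ)) ξ| ≤ C' * (1 + ξ ^ 2) ^ (2 * k) := by
        have h4 : 2 * deriv (U τ) ξ ^ 2 / ε ≤ 2 * C ^ 2 / ε * (1 + ξ ^ 2) ^ (2 * k) := by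
          rw [div_mul_eq_mul_div]; exact div_le_div_of_nonneg_right (by nlinarith) hε.le
        have h5 : |deriv (deriv (U τ)) ξ| ≤ C * (1 + ξ ^ 2) ^ (2 * k) := h2.trans (mul_le_mul_of_nonneg_left hP' hC0)
        have h6 : (2 * C ^ 2 / ε + C) * (1 + ξ ^ 2) ^ (2 * k) ≤ C' * (1 + ξ ^ 2) ^ (2 * k) :=
          mul_le_mul_of_nonneg_right (by simp only [hC']; linarith) (by positivity)
        nlinarith
      exact h.trans h3)
    hS hSA (fun τ ξ => hbd1 ξ _ (hS1b τ ξ))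
    (fun τ => by
      have hQc : Continuous (Q τ) := (contDiff_reg hε (hU2 τ)).continuous
      have hQi : Continuous fun ξ => (Q τ ξ)⁻¹ := hQc.inv₀ fun ξ => (hfacts τ ξ).1.ne'
      have hs'c : Continuous (deriv (S τ)) := (hS τ).continuous_deriv le_rfl
      simp only [hF]
      exact ((continuous_const.mul (continuous_const.add hs'c)).mul continuous_const).mul hQi)
    (fun τ ξ => by
      -- `|F| ≤ ½(1 + C(1+ξ²)^k)·ε ≤ ((1+C)/2·ε)(1+ξ²)^{2k}`
      obtain ⟨hq, -, -, hεq, -⟩ := hfacts τ ξ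
      have hr0 : 0 < (Q τ ξ)⁻¹ := inv_pos.2 hq
      have hrε : ε ^ 2 * (Q τ ξ)⁻¹ ≤ ε := by
        rw [← div_eq_mul_inv, div_le_iff₀ hq]; nlinarith
      have hs := hS1b τ ξ
      have hP := hP1 ξ
      have hP' := hPP ξ
      simp only [hF]
      rw [abs_mul, abs_mul, abs_mul, abs_of_pos hr0, abs_of_pos (by norm_num : (0:ℝ) < 1 / 2), abs_of_nonneg (sq_nonneg ε)]
      have h1 : |1 + deriv (S τ) ξ| ≤ (1 + C) * (1 + ξ ^ 2) ^ k := by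
        calc |1 + deriv (S τ) ξ| ≤ |(1:ℝ)| + |deriv (S τ) ξ| := abs_add_le _ _
          _ ≤ 1 * (1 + ξ ^ 2) ^ k + C * (1 + ξ ^ 2) ^ k := by rw [abs_one]; exact add_le_add (by linarith) hs
          _ = (1 + C) * (1 + ξ ^ 2) ^ k := by ring
      calc 1 / 2 * |1 + deriv (S τ) ξ| * ε ^ 2 * (Q τ ξ)⁻¹ = 1 / 2 * |1 + deriv (S τ) ξ| * (ε ^ 2 * (Q τ ξ)⁻¹) := by ring
        _ ≤ 1 / 2 * ((1 + C) * (1 + ξ ^ 2) ^ k) * ε :=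
            mul_le_mul (mul_le_mul_of_nonneg_left h1 (by norm_num)) hrε (by positivity) (by positivity)
        _ ≤ 1 / 2 * ((1 + C) * (1 + ξ ^ 2) ^ (2 * k)) * ε := by
            have : (1 + C) * (1 + ξ ^ 2) ^ k ≤ (1 + C) * (1 + ξ ^ 2) ^ (2 * k) := mul_le_mul_of_nonneg_left hP' (by positivity)
            nlinarith
        _ = (1 + C) / 2 * ε * (1 + ξ ^ 2) ^ (2 * k) := by ring)
    (fun τ ξ => by
      -- the forced subsolution inequality
      obtain ⟨hq, hq2, -, -, -⟩ := hfacts τ ξ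
      -- the flux derivatives
      have hVQ : HasDerivAt (fun ξ => (ξ + S τ ξ) * Q τ ξ)
          ((1 + deriv (S τ) ξ) * Q τ ξ + (ξ + S τ ξ) * (U τ ξ * deriv (U τ) ξ * (Q τ ξ)⁻¹)) ξ := by
        have h1 : HasDerivAt (fun ξ => ξ + S τ ξ) (1 + deriv (S τ) ξ) ξ := (hasDerivAt_id ξ).add (hSd τ ξ).hasDerivAt
        have h2 : HasDerivAt (Q τ) (U τ ξ * deriv (U τ) ξ * (Q τ ξ)⁻¹) ξ := by
          have h := hasDerivAt_reg (f := U τ) hε (hUd τ) ξ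
          rw [div_eq_mul_inv] at h
          exact h
        exact h1.mul h2
      have hVU : HasDerivAt (fun ξ => (ξ + S τ ξ) * U τ ξ)
          ((1 + deriv (S τ) ξ) * U τ ξ + (ξ + S τ ξ) * deriv (U τ) ξ) ξ := by
        have h1 : HasDerivAt (fun ξ => ξ + S τ ξ) (1 + deriv (S τ) ξ) ξ := (hasDerivAt_id ξ).add (hSd τ ξ).hasDerivAt
        exact h1.mul (hUd τ ξ).hasDerivAt
      rw [hVQ.deriv, hQ2 τ ξ]
      have hs := hsgn τ ξ
      rw [hVU.deriv] at hs
      simp only [hQt, hF]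
      have h := reg_forced_ineq (u := U τ ξ) (ut := Ut τ ξ) (u1 := deriv (U τ) ξ) (u2 := deriv (deriv (U τ)) ξ)
        (s := S τ ξ) (s1 := deriv (S τ) ξ) (ξ := ξ) (ε := ε) hq hq2 hs
      linarith)
  obtain ⟨hint, hle⟩ := key
  exact ⟨hint, hle⟩

/-! ### The signed Liouville theorem -/

/-- **ANCIENT LIOUVILLE FOR (OSC), SIGNED (KATO) FORM, POLYNOMIAL GROWTH, EVERY COMPRESSION.**  Let `U : ℝ → ℝ → ℝ` with `U(τ,·) ∈ C²`, time
derivative `Ut` (continuous in `ξ`), POLYNOMIAL bounds `|U|, |Ut|, |U_ξ|, |U_ξξ| ≤ C(1+ξ²)^k` uniformly in `τ`; `S(τ,·) ∈ C¹`, `|S| ≤ A` (`A > 0`),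
`|S_ξ| ≤ C(1+ξ²)^k`.  If the SIGNED inequality `U·(Ut + ½∂_ξ((ξ+S)U) − U_ξξ) ≤ 0` holds on `ℝ × ℝ` — i.e. `U` is a subsolution where positive and
a supersolution where negative — then `U ≡ 0`.  (No sign hypothesis on `U`, no boundedness, no weight hypothesis, no «K < 1/2».) -/
theorem eq_zero_of_ancient_signedSolution {U Ut S : ℝ → ℝ → ℝ} {A C : ℝ} {k : ℕ} (hA : 0 < A)
    (hU2 : ∀ τ, ContDiff ℝ 2 (U τ)) (hUt : ∀ τ ξ, HasDerivAt (fun τ' => U τ' ξ) (Ut τ ξ) τ) (hUtc : ∀ τ, Continuous (Ut τ))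
    (hUb : ∀ τ ξ, |U τ ξ| ≤ C * (1 + ξ ^ 2) ^ k)
    (hUtb : ∀ τ ξ, |Ut τ ξ| ≤ C * (1 + ξ ^ 2) ^ k) (hU1b : ∀ τ ξ, |deriv (U τ) ξ| ≤ C * (1 + ξ ^ 2) ^ k)
    (hU2b : ∀ τ ξ, |deriv (deriv (U τ)) ξ| ≤ C * (1 + ξ ^ 2) ^ k)
    (hS : ∀ τ, ContDiff ℝ 1 (S τ)) (hSA : ∀ τ ξ, |S τ ξ| ≤ A) (hS1b : ∀ τ ξ, |deriv (S τ) ξ| ≤ C * (1 + ξ ^ 2) ^ k)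
    (hsgn : ∀ τ ξ, U τ ξ * (Ut τ ξ + (1 / 2 : ℝ) * deriv (fun ξ => (ξ + S τ ξ) * U τ ξ) ξ - deriv (deriv (U τ)) ξ) ≤ 0) :
    ∀ τ ξ, U τ ξ = 0 := by
  obtain ⟨γ, κ, Cw, hγ, hκ, _hCw, w, hw2, _heven, hpos, _hmono, hineq, hdec, hdec', hdec''⟩ := exists_universalWeight₂ hA
  have hWint := weight_poly_integrable hw2 hκ hdec hdec' hdec'' (2 * (2 * k) + 1)
  have hC0 : 0 ≤ C := by
    have := (abs_nonneg _).trans (hUtb 0 0)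
    have hP : 0 < (1 + (0 : ℝ) ^ 2) ^ k := by positivity
    nlinarith
  have hwc : Continuous w := hw2.continuous
  set Pw : ℝ := ∫ ξ, (1 + ξ ^ 2) ^ (2 * k) * w ξ with hPw
  set L : ℝ := ((1 + C) / 2) / γ * Pw with hL
  -- `∫ |U| w ≤ ε·L` for every `0 < ε ≤ 1`
  have hPk : ∀ ξ : ℝ, (1 + ξ ^ 2) ^ k ≤ (1 + ξ ^ 2) ^ (2 * (2 * k) + 1) := fun ξ =>
    pow_le_pow_right₀ (by nlinarith [sq_nonneg ξ]) (by omega)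
  have hP1' : ∀ ξ : ℝ, 1 ≤ (1 + ξ ^ 2) ^ (2 * (2 * k) + 1) := fun ξ => one_le_pow₀ (by nlinarith [sq_nonneg ξ])
  have hGw : ∀ ξ, (1 + ξ ^ 2) ^ (2 * (2 * k) + 1) * |w ξ| ≤
      (1 + ξ ^ 2) ^ (2 * (2 * k) + 1) * (|w ξ| + |deriv w ξ| + |deriv (deriv w) ξ|) := fun ξ => by
    nlinarith [abs_nonneg (deriv w ξ), abs_nonneg (deriv (deriv w) ξ), hP1' ξ]
  have iUw : ∀ τ, Integrable fun ξ => |U τ ξ| * w ξ := fun τ =>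
    integrable_of_abs_le ((hU2 τ).continuous.abs.mul hwc) hWint C fun ξ => by
      have hb : |(|U τ ξ|)| ≤ C * (1 + ξ ^ 2) ^ k := by rw [abs_abs]; exact hUb τ ξ
      exact abs_mul_le_of_bounds hC0 hb (hPk ξ) (hGw ξ)
  have hmain : ∀ τ, ∀ ε, 0 < ε → ∫ ξ, |U τ ξ| * w ξ ≤ ε * L := by
    intro τ ε hε
    obtain ⟨hint, hle⟩ := weightedMass_reg_le hw2 hpos hγ hineq hWint hU2 hUt hUtc hUb hUtb hU1b hU2b hS hSA hS1b hsgn hε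
    have h1 : ∫ ξ, |U τ ξ| * w ξ ≤ ∫ ξ, Real.sqrt (U τ ξ ^ 2 + ε ^ 2) * w ξ :=
      integral_mono (iUw τ) (hint τ) fun ξ =>
        mul_le_mul_of_nonneg_right (reg_facts (u := U τ ξ) hε).2.2.1 (hpos ξ).le
    have h2 := hle τ
    have e : ((1 + C) / 2 * ε) / γ * Pw = ε * L := by simp only [hL]; ring
    rw [← hPw, e] at h2
    exact h1.trans h2
  -- hence `∫ |U| w ≤ 0`
  have hzero : ∀ τ, ∫ ξ, |U τ ξ| * w ξ = 0 := by
    intro τ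
    have hnonneg : 0 ≤ ∫ ξ, |U τ ξ| * w ξ := integral_nonneg fun ξ => mul_nonneg (abs_nonneg _) (hpos ξ).le
    refine le_antisymm ?_ hnonneg
    by_contra hcon
    push Not at hcon
    set m := ∫ ξ, |U τ ξ| * w ξ with hm
    have hL1 : m ≤ 1 * L := hmain τ 1 one_pos
    have hLpos : 0 < L := by linarith
    have h := hmain τ (m / (2 * L)) (div_pos hcon (by linarith))
    have h3 : m / (2 * L) * L = m / 2 := by field_simp
    linarith
  intro τ ξ
  have hf0 : (fun ξ => |U τ ξ| * w ξ) =ᵐ[volume] 0 :=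
    (integral_eq_zero_iff_of_nonneg (fun ξ => mul_nonneg (abs_nonneg _) (hpos ξ).le) (iUw τ)).1 (hzero τ)
  have hcont : Continuous fun ξ => |U τ ξ| * w ξ := (hU2 τ).continuous.abs.mul hwc
  have hz : (fun ξ => |U τ ξ| * w ξ) = 0 := (hcont.ae_eq_iff_eq volume continuous_const).1 hf0
  have := congrFun hz ξ
  simp only [Pi.zero_apply, mul_eq_zero] at this
  exact abs_eq_zero.1 (this.resolve_right (hpos ξ).ne')

end Summit.NavierStokesRegularity.NavierStokesRegularity.Theorems.PoloidalWindowDoorLrcModEntireTwistingTHOscSignedLiouville
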